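import Mathlib
import HarnessLib
import Summits.HubbardSuperconductivity.HubbardSuperconductivity.Theorems.KLProgrammeC4aCompositeJetCounting
import Summits.HubbardSuperconductivity.HubbardSuperconductivity.Theorems.KLProgrammeC4aBubbleTubeDerivAll
import Summits.HubbardSuperconductivity.HubbardSuperconductivity.Theorems.KLProgrammeC4aLatticeTubeSum
import Summits.HubbardSuperconductivity.HubbardSuperconductivity.Theorems.KLProgrammeC4aTadpoleJetAssemblyRef

/-!
# Route `KLProgramme` — crux C4a, S3 brick (B3, PARTITION): the SWAP `p ↦ R − p` on the zone box, the three-piece tube/far partition of the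
# co-moving bubble, and the far-far piece differentiated under the zone integral at every order

Cell `gate-hubbard-kl`, seat hubbard-kl-k3c3-p3 (g24; row «implicit-function / monotonicity route»).  Part 2 of the located brick «(B3)-ALL-ORDERS»
for the (C)-closer lane (stub (C) `stub_twoLeg_curvature` of `KLRegimeEngineV17F2`, stmt-HubbardSuperconductivity-20437): C4A-PLAN §24.9 (i)/(iv),
§24.11 «(B3) completion … tube/far partition».  The continuum pp bubble read at `R` is the zone integral
`B(R) = ∫_{(−π,π)²} Ψ₁(e_K q̂)·Ψ₂(e_K(R − q̂)) dq` (`q̂ = toLp ![q.1, q.2]`); with a level cut-off `χ` of the tube it splits as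
`B = T₁ + T₂ + FF`, `T₁ =` loop line on the tube (profile `χΨ₁`), `T₂ =` partner on the tube — which must be read with the partner as the TUBE
variable (co-moving, §24.4), i.e. after the swap `q ↦ R − q` — and the far-far piece `FF` (both lines off the Fermi curve):

* §1 the swap: `setIntegral_Ioo_comp_sub_of_periodic` (one `2π`-periodic variable), **`setIntegral_zoneBox_comp_sub`**
  (`∫_{(−π,π)²} F(S − p) dp = ∫_{(−π,π)²} F(p) dp` for continuous coordinate-periodic `F`; Fubini + substitution + `Periodic.intervalIntegral_add_eq`),
  `toLp_pair_sub`, `toLp_pair_add_two_pi_fst/snd`, **`zoneBox_swap`** (`∫ Φ₁(q̂)·Φ₂(R − q̂) = ∫ Φ₂(q̂)·Φ₁(R − q̂)` for continuous coordinate-periodic `Φᵢ` on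
  the momentum plane — the lattice sum cannot be swapped at a continuum `R`, the zone integral can);
* §2 **`zoneBox_bubble_eq_three_pieces`** — `B(R) = ∫(χΨ₁)(e_K q̂)·Ψ₂(e_K(R−q̂)) + ∫(χΨ₂)(e_K q̂)·((1−χ)Ψ₁)(e_K(R−q̂)) + ∫((1−χ)Ψ₁)(e_K q̂)·((1−χ)Ψ₂)(e_K(R−q̂))`,
  both tube pieces in the shape of `setIntegral_zoneBox_eq_tube` / `bubbleTube_pp_eq_levelIntegral` (profile `f = χΨᵢ` supported in the tube);
* §3 the far-far piece at the co-moving pair momentum `R = Φ(0,θ) + Φ(ρ′,ϑ′+θ)`: `iteratedDeriv_zoneBoxIntegral_eq` (every derivative under the zone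
  integral, from `iteratedDeriv_parametric_integral_eq`), `contDiff_farIntegrand_pp`, **`iteratedDeriv_farIntegral_pp_eq`**
  (`∂ᵏ_θ ∫ g(q̂)·H(e_K(R(θ) − q̂)) dq = ∫ g(q̂)·∂ᵏ_θ[H(e_K(R(θ) − q̂))] dq`), `contDiff_farIntegral_pp`, `norm_iteratedDeriv_farIntegral_pp_le`, and the
  counting with NO small factor `norm_iteratedDeriv_scomp_le_factorial_one` (`‖∂ᵏ_θ H(E(θ))‖ ≤ k!·Dᵏ·Σ_{L=1}^{k} M_L`: n-free as soon as `H = (1−χ)Ψ₂`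
  has n-free derivative bounds off the Fermi curve — the (B4) input).

Measure-theoretic bookkeeping on landed objects; nothing about the model's sizes; nothing asserts superconductivity.  References: FST II CPAM 51 (1998) §3;
BGM 2006 §2.1 (2.3), §2.4 (2.40) [cite: BenfattoGiulianiMastropietro2006].
-/

noncomputable section

namespace Summit.HubbardSuperconductivity.HubbardSuperconductivity.Theorems.C4a

set_option linter.dupNamespace false -- summit = problem name (single-conjunct summit), D-0017

open Real Set Filter MeasureTheory Metric
open scoped Topology ContDiff
open Literature.MathematicalPhysics.QuantumLattice Literature.MathematicalPhysics.QuantumLattice.BandSectorCounting Literature.Probability.LatticeModels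
open Summit.HubbardSuperconductivity.HubbardSuperconductivity.Theorems.KLRegimeSplit
open Summit.HubbardSuperconductivity.HubbardSuperconductivity.Theorems.DispersionFlow
open Summit.HubbardSuperconductivity.HubbardSuperconductivity.Theorems.PerturbedFermiCurve

/-! ## §1 The swap `p ↦ S − p` on the zone box -/

section Swap

variable {E' : Type*} [NormedAddCommGroup E'] [NormedSpace ℝ E']

/-- One periodic variable: `∫_{(−π,π)} g(d − y) dy = ∫_{(−π,π)} g(y) dy` for `2π`-periodic `g`. [folklore] -/
theorem setIntegral_Ioo_comp_sub_of_periodic {g : ℝ → E'} (hg : Function.Periodic g (2 * π)) (d : ℝ) :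
    ∫ y in Ioo (-π) π, g (d - y) = ∫ y in Ioo (-π) π, g y := by
  rw [setIntegral_congr_set Ioo_ae_eq_Ioc, setIntegral_congr_set Ioo_ae_eq_Ioc,
    ← intervalIntegral.integral_of_le (by linarith [pi_pos]), ← intervalIntegral.integral_of_le (by linarith [pi_pos]),
    intervalIntegral.integral_comp_sub_left (fun y => g y) d]
  have h := hg.intervalIntegral_add_eq (d - π) (-π)
  rw [show d - π + 2 * π = d - -π by ring, show -π + 2 * π = π by ring] at h
  exact h

/-- **THE SWAP ON THE ZONE BOX**: for a continuous `F : ℝ × ℝ → E'` that is `2π`-periodic in each coordinate and any `S`,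
`∫_{(−π,π)²} F(S − p) dp = ∫_{(−π,π)²} F(p) dp` (Fubini, substitution and the periodic shift in each variable). [folklore] -/
theorem setIntegral_zoneBox_comp_sub {F : ℝ × ℝ → E'} (hF : Continuous F)
    (h1 : ∀ x y, F (x + 2 * π, y) = F (x, y)) (h2 : ∀ x y, F (x, y + 2 * π) = F (x, y)) (S : ℝ × ℝ) :
    ∫ p in Ioo (-π) π ×ˢ Ioo (-π) π, F (S - p) = ∫ p in Ioo (-π) π ×ˢ Ioo (-π) π, F p := by
  have hsub : (Ioo (-π) π ×ˢ Ioo (-π) π : Set (ℝ × ℝ)) ⊆ Icc (-π) π ×ˢ Icc (-π) π := Set.prod_mono Ioo_subset_Icc_self Ioo_subset_Icc_self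
  have hintF : IntegrableOn F (Ioo (-π) π ×ˢ Ioo (-π) π) :=
    (hF.continuousOn.integrableOn_compact (isCompact_Icc.prod isCompact_Icc)).mono_set hsub
  have hintFS : IntegrableOn (fun p => F (S - p)) (Ioo (-π) π ×ˢ Ioo (-π) π) :=
    ((hF.comp (continuous_const.sub continuous_id)).continuousOn.integrableOn_compact (isCompact_Icc.prod isCompact_Icc)).mono_set hsub
  rw [Measure.volume_eq_prod] at hintF hintFS ⊢
  rw [setIntegral_prod _ hintFS, setIntegral_prod _ hintF]
  -- the inner variable
  have hinner : ∀ x, ∫ y in Ioo (-π) π, F (S - (x, y)) = ∫ y in Ioo (-π) π, F (S.1 - x, y) := fun x => by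
    have hper : Function.Periodic (fun y' => F (S.1 - x, y')) (2 * π) := fun y' => h2 _ _
    have hfun : (fun y : ℝ => F (S - (x, y))) = fun y : ℝ => (fun y' => F (S.1 - x, y')) (S.2 - y) := by
      funext y; rfl
    rw [hfun]
    exact setIntegral_Ioo_comp_sub_of_periodic hper S.2
  have hI : (fun x : ℝ => ∫ y in Ioo (-π) π, F (S - (x, y))) = fun x : ℝ => (fun x' : ℝ => ∫ y in Ioo (-π) π, F (x', y)) (S.1 - x) :=
    funext hinner
  rw [hI]
  have hper : Function.Periodic (fun x' : ℝ => ∫ y in Ioo (-π) π, F (x', y)) (2 * π) := fun x' => by simp only [h1]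
  exact setIntegral_Ioo_comp_sub_of_periodic hper S.1

/-- Coordinates of a difference: `toLp ![a − c, b − d] = toLp ![a, b] − toLp ![c, d]`. -/
theorem toLp_pair_sub (a b c d : ℝ) :
    (WithLp.toLp 2 ![a - c, b - d] : Momentum) = WithLp.toLp 2 ![a, b] - WithLp.toLp 2 ![c, d] := by
  rw [← WithLp.toLp_sub]
  congr 1
  funext i
  fin_cases i <;> simp

/-- Shifting the first coordinate by `2π`: `toLp ![x + 2π, y] = toLp ![x, y] + single 0 (2π)`. -/
theorem toLp_pair_add_two_pi_fst (x y : ℝ) :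
    (WithLp.toLp 2 ![x + 2 * π, y] : Momentum) = WithLp.toLp 2 ![x, y] + EuclideanSpace.single 0 (2 * π) := by
  ext i
  fin_cases i <;> simp

/-- Shifting the second coordinate by `2π`: `toLp ![x, y + 2π] = toLp ![x, y] + single 1 (2π)`. -/
theorem toLp_pair_add_two_pi_snd (x y : ℝ) :
    (WithLp.toLp 2 ![x, y + 2 * π] : Momentum) = WithLp.toLp 2 ![x, y] + EuclideanSpace.single 1 (2 * π) := by
  ext i
  fin_cases i <;> simp

/-- A coordinate-periodic function is also periodic under the negative shift. -/
theorem periodic_single_neg {E : Type*} {Φ : Momentum → E} (hper : ∀ (j : Fin 2) (q : Momentum), Φ (q + EuclideanSpace.single j (2 * π)) = Φ q)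
    (j : Fin 2) (q : Momentum) : Φ (q - EuclideanSpace.single j (2 * π)) = Φ q := by
  have h := hper j (q - EuclideanSpace.single j (2 * π))
  rw [sub_add_cancel] at h
  exact h.symm

/-- The coordinate map `p ↦ toLp ![p.1, p.2]` is smooth. -/
theorem contDiff_toLp_pair {n : WithTop ℕ∞} : ContDiff ℝ n fun p : ℝ × ℝ => (WithLp.toLp 2 ![p.1, p.2] : Momentum) := by
  refine (PiLp.continuousLinearEquiv 2 ℝ (fun _ : Fin 2 => ℝ)).symm.contDiff.comp ?_
  refine contDiff_pi.2 fun i => ?_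
  fin_cases i
  · exact contDiff_fst
  · exact contDiff_snd

/-- **THE SWAP FOR A PRODUCT ON THE MOMENTUM PLANE**: for continuous `Φ₁, Φ₂ : Momentum → ℂ`, `2π`-periodic in each coordinate, and any `R`,
`∫_{(−π,π)²} Φ₁(q̂)·Φ₂(R − q̂) dq = ∫_{(−π,π)²} Φ₂(q̂)·Φ₁(R − q̂) dq`. -/
theorem zoneBox_swap {Φ₁ Φ₂ : Momentum → ℂ} (hΦ₁ : Continuous Φ₁) (hΦ₂ : Continuous Φ₂)
    (hp₁ : ∀ (j : Fin 2) (q : Momentum), Φ₁ (q + EuclideanSpace.single j (2 * π)) = Φ₁ q)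
    (hp₂ : ∀ (j : Fin 2) (q : Momentum), Φ₂ (q + EuclideanSpace.single j (2 * π)) = Φ₂ q) (R : Momentum) :
    ∫ p in Ioo (-π) π ×ˢ Ioo (-π) π, Φ₁ (WithLp.toLp 2 ![p.1, p.2]) * Φ₂ (R - WithLp.toLp 2 ![p.1, p.2]) =
      ∫ p in Ioo (-π) π ×ˢ Ioo (-π) π, Φ₂ (WithLp.toLp 2 ![p.1, p.2]) * Φ₁ (R - WithLp.toLp 2 ![p.1, p.2]) := by
  set F : ℝ × ℝ → ℂ := fun p => Φ₂ (WithLp.toLp 2 ![p.1, p.2]) * Φ₁ (R - WithLp.toLp 2 ![p.1, p.2]) with hFdef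
  have hF : Continuous F := (hΦ₂.comp continuous_coordToLp).mul (hΦ₁.comp (continuous_const.sub continuous_coordToLp))
  have h1 : ∀ x y, F (x + 2 * π, y) = F (x, y) := fun x y => by
    simp only [hFdef, toLp_pair_add_two_pi_fst, ← sub_sub, hp₂, periodic_single_neg hp₁]
  have h2 : ∀ x y, F (x, y + 2 * π) = F (x, y) := fun x y => by
    simp only [hFdef, toLp_pair_add_two_pi_snd, ← sub_sub, hp₂, periodic_single_neg hp₁]
  have hswap := setIntegral_zoneBox_comp_sub hF h1 h2 (R 0, R 1)
  have hSF : ∀ p : ℝ × ℝ, F ((R 0, R 1) - p) = Φ₁ (WithLp.toLp 2 ![p.1, p.2]) * Φ₂ (R - WithLp.toLp 2 ![p.1, p.2]) := fun p => by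
    have hR : R = WithLp.toLp 2 ![R 0, R 1] := by ext i; fin_cases i <;> simp
    have hc : (WithLp.toLp 2 ![((R 0, R 1) - p).1, ((R 0, R 1) - p).2] : Momentum) = R - WithLp.toLp 2 ![p.1, p.2] := by
      rw [Prod.fst_sub, Prod.snd_sub, toLp_pair_sub, ← hR]
    simp only [hFdef, hc, sub_sub_cancel, mul_comm]
  simp only [hSF] at hswap
  exact hswap

end Swap

/-! ## §2 The three-piece tube/far partition of the co-moving bubble -/

section Partition

/-- The pointwise partition `Ψ₁(a)Ψ₂(b) = (χΨ₁)(a)·Ψ₂(b) + ((1−χ)Ψ₁)(a)·(χΨ₂)(b) + ((1−χ)Ψ₁)(a)·((1−χ)Ψ₂)(b)`. -/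
theorem bubble_integrand_partition (χ Ψ₁ Ψ₂ : ℝ → ℂ) (a b : ℝ) :
    Ψ₁ a * Ψ₂ b = χ a * Ψ₁ a * Ψ₂ b + (1 - χ a) * Ψ₁ a * (χ b * Ψ₂ b) + (1 - χ a) * Ψ₁ a * ((1 - χ b) * Ψ₂ b) := by ring

/-- Integrability on the zone box of a continuous integrand. -/
theorem integrableOn_zoneBox_of_continuous {E' : Type*} [NormedAddCommGroup E'] {F : ℝ × ℝ → E'} (hF : Continuous F) :
    IntegrableOn F (Ioo (-π) π ×ˢ Ioo (-π) π) :=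
  (hF.continuousOn.integrableOn_compact (isCompact_Icc.prod isCompact_Icc)).mono_set (Set.prod_mono Ioo_subset_Icc_self Ioo_subset_Icc_self)

/-- **THE THREE-PIECE PARTITION OF THE CO-MOVING BUBBLE** (pp, any pair momentum `R`): for continuous `χ, Ψ₁, Ψ₂`,
`∫ Ψ₁(e_K q̂)Ψ₂(e_K(R−q̂)) = ∫ (χΨ₁)(e_K q̂)·Ψ₂(e_K(R−q̂)) + ∫ (χΨ₂)(e_K q̂)·((1−χ)Ψ₁)(e_K(R−q̂)) + ∫ ((1−χ)Ψ₁)(e_K q̂)·((1−χ)Ψ₂)(e_K(R−q̂))`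
over the zone box `(−π,π)²` — the middle piece SWAPPED so that its tube variable is the partner's. -/
theorem zoneBox_bubble_eq_three_pieces (μ : ℝ) (K : TrigPolyC4v) {χ Ψ₁ Ψ₂ : ℝ → ℂ} (hχ : Continuous χ) (hΨ₁ : Continuous Ψ₁) (hΨ₂ : Continuous Ψ₂)
    (R : Momentum) :
    ∫ p in Ioo (-π) π ×ˢ Ioo (-π) π, Ψ₁ (frameLevel μ K (WithLp.toLp 2 ![p.1, p.2])) * Ψ₂ (frameLevel μ K (R - WithLp.toLp 2 ![p.1, p.2])) =
      (∫ p in Ioo (-π) π ×ˢ Ioo (-π) π,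
          χ (frameLevel μ K (WithLp.toLp 2 ![p.1, p.2])) * Ψ₁ (frameLevel μ K (WithLp.toLp 2 ![p.1, p.2])) *
            Ψ₂ (frameLevel μ K (R - WithLp.toLp 2 ![p.1, p.2]))) +
      (∫ p in Ioo (-π) π ×ˢ Ioo (-π) π,
          χ (frameLevel μ K (WithLp.toLp 2 ![p.1, p.2])) * Ψ₂ (frameLevel μ K (WithLp.toLp 2 ![p.1, p.2])) *
            ((1 - χ (frameLevel μ K (R - WithLp.toLp 2 ![p.1, p.2]))) * Ψ₁ (frameLevel μ K (R - WithLp.toLp 2 ![p.1, p.2])))) +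
      ∫ p in Ioo (-π) π ×ˢ Ioo (-π) π,
          (1 - χ (frameLevel μ K (WithLp.toLp 2 ![p.1, p.2]))) * Ψ₁ (frameLevel μ K (WithLp.toLp 2 ![p.1, p.2])) *
            ((1 - χ (frameLevel μ K (R - WithLp.toLp 2 ![p.1, p.2]))) * Ψ₂ (frameLevel μ K (R - WithLp.toLp 2 ![p.1, p.2]))) := by
  have he : Continuous (frameLevel μ K) := (EngineV8.contDiff_frameLevel μ K (n := 0)).continuous
  have hq : Continuous fun p : ℝ × ℝ => frameLevel μ K (WithLp.toLp 2 ![p.1, p.2]) := he.comp continuous_coordToLp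
  have hRq : Continuous fun p : ℝ × ℝ => frameLevel μ K (R - WithLp.toLp 2 ![p.1, p.2]) := he.comp (continuous_const.sub continuous_coordToLp)
  -- integrability of the three pieces
  have hI1 : IntegrableOn (fun p : ℝ × ℝ => χ (frameLevel μ K (WithLp.toLp 2 ![p.1, p.2])) * Ψ₁ (frameLevel μ K (WithLp.toLp 2 ![p.1, p.2])) *
      Ψ₂ (frameLevel μ K (R - WithLp.toLp 2 ![p.1, p.2]))) (Ioo (-π) π ×ˢ Ioo (-π) π) :=
    integrableOn_zoneBox_of_continuous (((hχ.comp hq).mul (hΨ₁.comp hq)).mul (hΨ₂.comp hRq))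
  have hI2 : IntegrableOn (fun p : ℝ × ℝ => (1 - χ (frameLevel μ K (WithLp.toLp 2 ![p.1, p.2]))) * Ψ₁ (frameLevel μ K (WithLp.toLp 2 ![p.1, p.2])) *
      (χ (frameLevel μ K (R - WithLp.toLp 2 ![p.1, p.2])) * Ψ₂ (frameLevel μ K (R - WithLp.toLp 2 ![p.1, p.2])))) (Ioo (-π) π ×ˢ Ioo (-π) π) :=
    integrableOn_zoneBox_of_continuous ((((continuous_const.sub (hχ.comp hq)).mul (hΨ₁.comp hq))).mul ((hχ.comp hRq).mul (hΨ₂.comp hRq)))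
  have hI3 : IntegrableOn (fun p : ℝ × ℝ => (1 - χ (frameLevel μ K (WithLp.toLp 2 ![p.1, p.2]))) * Ψ₁ (frameLevel μ K (WithLp.toLp 2 ![p.1, p.2])) *
      ((1 - χ (frameLevel μ K (R - WithLp.toLp 2 ![p.1, p.2]))) * Ψ₂ (frameLevel μ K (R - WithLp.toLp 2 ![p.1, p.2])))) (Ioo (-π) π ×ˢ Ioo (-π) π) :=
    integrableOn_zoneBox_of_continuous ((((continuous_const.sub (hχ.comp hq)).mul (hΨ₁.comp hq))).mul
      ((continuous_const.sub (hχ.comp hRq)).mul (hΨ₂.comp hRq)))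
  -- split
  have hsplit : ∫ p in Ioo (-π) π ×ˢ Ioo (-π) π, Ψ₁ (frameLevel μ K (WithLp.toLp 2 ![p.1, p.2])) * Ψ₂ (frameLevel μ K (R - WithLp.toLp 2 ![p.1, p.2])) =
      (∫ p in Ioo (-π) π ×ˢ Ioo (-π) π,
          χ (frameLevel μ K (WithLp.toLp 2 ![p.1, p.2])) * Ψ₁ (frameLevel μ K (WithLp.toLp 2 ![p.1, p.2])) *
            Ψ₂ (frameLevel μ K (R - WithLp.toLp 2 ![p.1, p.2]))) +
      (∫ p in Ioo (-π) π ×ˢ Ioo (-π) π,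
          (1 - χ (frameLevel μ K (WithLp.toLp 2 ![p.1, p.2]))) * Ψ₁ (frameLevel μ K (WithLp.toLp 2 ![p.1, p.2])) *
            (χ (frameLevel μ K (R - WithLp.toLp 2 ![p.1, p.2])) * Ψ₂ (frameLevel μ K (R - WithLp.toLp 2 ![p.1, p.2])))) +
      ∫ p in Ioo (-π) π ×ˢ Ioo (-π) π,
          (1 - χ (frameLevel μ K (WithLp.toLp 2 ![p.1, p.2]))) * Ψ₁ (frameLevel μ K (WithLp.toLp 2 ![p.1, p.2])) *
            ((1 - χ (frameLevel μ K (R - WithLp.toLp 2 ![p.1, p.2]))) * Ψ₂ (frameLevel μ K (R - WithLp.toLp 2 ![p.1, p.2]))) := by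
    have hI12 : IntegrableOn (fun p : ℝ × ℝ =>
        χ (frameLevel μ K (WithLp.toLp 2 ![p.1, p.2])) * Ψ₁ (frameLevel μ K (WithLp.toLp 2 ![p.1, p.2])) *
            Ψ₂ (frameLevel μ K (R - WithLp.toLp 2 ![p.1, p.2])) +
          (1 - χ (frameLevel μ K (WithLp.toLp 2 ![p.1, p.2]))) * Ψ₁ (frameLevel μ K (WithLp.toLp 2 ![p.1, p.2])) *
            (χ (frameLevel μ K (R - WithLp.toLp 2 ![p.1, p.2])) * Ψ₂ (frameLevel μ K (R - WithLp.toLp 2 ![p.1, p.2]))))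
        (Ioo (-π) π ×ˢ Ioo (-π) π) := hI1.add hI2
    rw [← integral_add hI1 hI2, ← integral_add hI12 hI3]
    refine setIntegral_congr_fun (measurableSet_Ioo.prod measurableSet_Ioo) fun p _ => ?_
    exact bubble_integrand_partition χ Ψ₁ Ψ₂ _ _
  rw [hsplit]
  congr 2
  -- swap the middle piece
  have hper : ∀ (g : ℝ → ℂ) (j : Fin 2) (q : Momentum), (fun q : Momentum => g (frameLevel μ K q)) (q + EuclideanSpace.single j (2 * π)) =
      (fun q : Momentum => g (frameLevel μ K q)) q := fun g j q => by simp only [frameLevel_periodic_single]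
  have h := zoneBox_swap (Φ₁ := fun q : Momentum => (1 - χ (frameLevel μ K q)) * Ψ₁ (frameLevel μ K q))
    (Φ₂ := fun q : Momentum => χ (frameLevel μ K q) * Ψ₂ (frameLevel μ K q))
    ((continuous_const.sub (hχ.comp he)).mul (hΨ₁.comp he)) ((hχ.comp he).mul (hΨ₂.comp he))
    (hper (fun e => (1 - χ e) * Ψ₁ e)) (hper (fun e => χ e * Ψ₂ e)) R
  exact h

/-- The same split over the lane's half-open zone box `[−π,π)²` (edges are null). -/
theorem zoneBoxIco_bubble_eq_three_pieces (μ : ℝ) (K : TrigPolyC4v) {χ Ψ₁ Ψ₂ : ℝ → ℂ} (hχ : Continuous χ) (hΨ₁ : Continuous Ψ₁)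
    (hΨ₂ : Continuous Ψ₂) (R : Momentum) :
    ∫ p in Ico (-π) π ×ˢ Ico (-π) π, Ψ₁ (frameLevel μ K (WithLp.toLp 2 ![p.1, p.2])) * Ψ₂ (frameLevel μ K (R - WithLp.toLp 2 ![p.1, p.2])) =
      (∫ p in Ico (-π) π ×ˢ Ico (-π) π,
          χ (frameLevel μ K (WithLp.toLp 2 ![p.1, p.2])) * Ψ₁ (frameLevel μ K (WithLp.toLp 2 ![p.1, p.2])) *
            Ψ₂ (frameLevel μ K (R - WithLp.toLp 2 ![p.1, p.2]))) +
      (∫ p in Ico (-π) π ×ˢ Ico (-π) π,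
          χ (frameLevel μ K (WithLp.toLp 2 ![p.1, p.2])) * Ψ₂ (frameLevel μ K (WithLp.toLp 2 ![p.1, p.2])) *
            ((1 - χ (frameLevel μ K (R - WithLp.toLp 2 ![p.1, p.2]))) * Ψ₁ (frameLevel μ K (R - WithLp.toLp 2 ![p.1, p.2])))) +
      ∫ p in Ico (-π) π ×ˢ Ico (-π) π,
          (1 - χ (frameLevel μ K (WithLp.toLp 2 ![p.1, p.2]))) * Ψ₁ (frameLevel μ K (WithLp.toLp 2 ![p.1, p.2])) *
            ((1 - χ (frameLevel μ K (R - WithLp.toLp 2 ![p.1, p.2]))) * Ψ₂ (frameLevel μ K (R - WithLp.toLp 2 ![p.1, p.2]))) := by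
  have hae : (Ico (-π) π ×ˢ Ico (-π) π : Set (ℝ × ℝ)) =ᵐ[volume] (Ioo (-π) π ×ˢ Ioo (-π) π : Set (ℝ × ℝ)) :=
    Measure.set_prod_ae_eq (Ioo_ae_eq_Ico (μ := volume) (a := -π) (b := π)).symm (Ioo_ae_eq_Ico (μ := volume) (a := -π) (b := π)).symm
  simp only [setIntegral_congr_set hae]
  exact zoneBox_bubble_eq_three_pieces μ K hχ hΨ₁ hΨ₂ R

end Partition

/-! ## §3 The far-far piece at the co-moving pair momentum: every derivative under the zone integral -/

section Far

variable {F : Type*} [NormedAddCommGroup F] [NormedSpace ℝ F]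

/-- The zone box carries Lebesgue measure a.e. inside the compact square `[−π,π]²`, and finite mass. -/
theorem ae_restrict_zoneBox_mem_Icc :
    ∀ᵐ q ∂(volume.restrict (Ioo (-π) π ×ˢ Ioo (-π) π : Set (ℝ × ℝ))), (id q : ℝ × ℝ) ∈ (Icc (-π) π ×ˢ Icc (-π) π : Set (ℝ × ℝ)) :=
  (ae_restrict_mem (measurableSet_Ioo.prod measurableSet_Ioo)).mono fun _ h => ⟨Ioo_subset_Icc_self h.1, Ioo_subset_Icc_self h.2⟩

/-- The zone box has finite Lebesgue measure. -/
theorem isFiniteMeasure_restrict_zoneBox : IsFiniteMeasure (volume.restrict (Ioo (-π) π ×ˢ Ioo (-π) π : Set (ℝ × ℝ))) :=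
  isFiniteMeasure_restrict.2 (((measure_mono (Set.prod_mono Ioo_subset_Icc_self Ioo_subset_Icc_self)).trans_lt
    (isCompact_Icc.prod isCompact_Icc).measure_lt_top).ne)

/-- **Every derivative under the zone integral**: for `G : (ℝ × ℝ) × ℝ → F` of class `C^∞`,
`∂ᵏ_θ ∫_{(−π,π)²} G(q,θ) dq = ∫_{(−π,π)²} ∂ᵏ_θ[G(q,·)](θ) dq`. [folklore] -/
theorem iteratedDeriv_zoneBoxIntegral_eq {G : (ℝ × ℝ) × ℝ → F} (hG : ContDiff ℝ ∞ G) (k : ℕ) (θ : ℝ) :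
    iteratedDeriv k (fun θ : ℝ => ∫ q in Ioo (-π) π ×ˢ Ioo (-π) π, G (q, θ)) θ =
      ∫ q in Ioo (-π) π ×ˢ Ioo (-π) π, iteratedDeriv k (fun θ : ℝ => G (q, θ)) θ := by
  haveI := isFiniteMeasure_restrict_zoneBox
  exact iteratedDeriv_parametric_integral_eq (ν := volume.restrict (Ioo (-π) π ×ˢ Ioo (-π) π : Set (ℝ × ℝ))) measurable_id
    (isCompact_Icc.prod isCompact_Icc) ae_restrict_zoneBox_mem_Icc k hG θ

/-- The zone integral of a jointly smooth integrand is `C^∞` in the base angle. [folklore] -/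
theorem contDiff_zoneBoxIntegral {G : (ℝ × ℝ) × ℝ → F} (hG : ContDiff ℝ ∞ G) :
    ContDiff ℝ ∞ fun θ : ℝ => ∫ q in Ioo (-π) π ×ˢ Ioo (-π) π, G (q, θ) := by
  haveI := isFiniteMeasure_restrict_zoneBox
  exact Literature.Analysis.FunctionSpaces.contDiff_parametric_integral (μ := volume.restrict (Ioo (-π) π ×ˢ Ioo (-π) π : Set (ℝ × ℝ)))
    measurable_id (isCompact_Icc.prod isCompact_Icc) ae_restrict_zoneBox_mem_Icc hG

/-- Majorants pass under the zone integral. [folklore] -/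
theorem norm_iteratedDeriv_zoneBoxIntegral_le {G : (ℝ × ℝ) × ℝ → F} (hG : ContDiff ℝ ∞ G) (k : ℕ) (θ : ℝ) {m : ℝ × ℝ → ℝ}
    (hmi : IntegrableOn m (Ioo (-π) π ×ˢ Ioo (-π) π))
    (hm : ∀ q ∈ (Ioo (-π) π ×ˢ Ioo (-π) π : Set (ℝ × ℝ)), ‖iteratedDeriv k (fun θ : ℝ => G (q, θ)) θ‖ ≤ m q) :
    ‖iteratedDeriv k (fun θ : ℝ => ∫ q in Ioo (-π) π ×ˢ Ioo (-π) π, G (q, θ)) θ‖ ≤ ∫ q in Ioo (-π) π ×ˢ Ioo (-π) π, m q := by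
  haveI := isFiniteMeasure_restrict_zoneBox
  exact norm_iteratedDeriv_parametric_integral_le (ν := volume.restrict (Ioo (-π) π ×ˢ Ioo (-π) π : Set (ℝ × ℝ))) measurable_id
    (isCompact_Icc.prod isCompact_Icc) ae_restrict_zoneBox_mem_Icc hG k θ hmi
    ((ae_restrict_mem (measurableSet_Ioo.prod measurableSet_Ioo)).mono hm)

variable {a b : ℝ} (B : BandBounds a b) {K : TrigPolyC4v} {A : ℝ}
  (hA : ∀ p : Momentum, ∀ j ≤ 2, ‖iteratedFDeriv ℝ j (frameShift K) p‖ ≤ A) (hADt : 2 * A < B.Dtmin)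
  {μ r : ℝ} (hlo : a < μ - r - A) (hhi : μ + r + A < b)
include B hA hADt hlo hhi

/-- The co-moving partner argument of the far piece, `θ ↦ H(e_K(Φ(0,θ) + Φ(ρ′,ϑ′+θ) − q̂))`, is `C^∞` in `θ` (each `q`). -/
theorem contDiff_farPartner_pp {H : ℝ → ℂ} (hH : ContDiff ℝ ∞ H) {ρ' : ℝ} (hρ' : |ρ'| < r) (ϑ' : ℝ) (q : Momentum) {n : ℕ∞} :
    ContDiff ℝ n fun θ : ℝ => H (frameLevel μ K (levelPoint μ K 0 θ + levelPoint μ K ρ' (ϑ' + θ) - q)) := by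
  have h0 : |(0 : ℝ)| < r := by rw [abs_zero]; exact (abs_nonneg ρ').trans_lt hρ'
  have hl : ∀ {x : ℝ}, |x| < r → ContDiff ℝ n (levelPoint μ K x) := fun hx => contDiff_levelPoint_angle B hA hADt hlo hhi hx
  exact (hH.of_le (mod_cast le_top)).comp ((EngineV8.contDiff_frameLevel μ K).comp
    (((hl h0).add ((hl hρ').comp (contDiff_const.add contDiff_id))).sub contDiff_const))

/-- **The far-far integrand is jointly `C^∞`** in (zone point, base angle): `(q,θ) ↦ g(q̂)·H(e_K(Φ(0,θ) + Φ(ρ′,ϑ′+θ) − q̂))`. -/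
theorem contDiff_farIntegrand_pp {g : Momentum → ℂ} (hg : ContDiff ℝ ∞ g) {H : ℝ → ℂ} (hH : ContDiff ℝ ∞ H) {ρ' : ℝ} (hρ' : |ρ'| < r)
    (ϑ' : ℝ) :
    ContDiff ℝ ∞ fun z : (ℝ × ℝ) × ℝ => g (WithLp.toLp 2 ![z.1.1, z.1.2]) *
      H (frameLevel μ K (levelPoint μ K 0 z.2 + levelPoint μ K ρ' (ϑ' + z.2) - WithLp.toLp 2 ![z.1.1, z.1.2])) := by
  have h0 : |(0 : ℝ)| < r := by rw [abs_zero]; exact (abs_nonneg ρ').trans_lt hρ'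
  have hl : ∀ {x : ℝ}, |x| < r → ContDiff ℝ ∞ (levelPoint μ K x) := fun hx => contDiff_levelPoint_angle B hA hADt hlo hhi hx
  have hc : ContDiff ℝ ∞ fun z : (ℝ × ℝ) × ℝ => (WithLp.toLp 2 ![z.1.1, z.1.2] : Momentum) := contDiff_toLp_pair.comp contDiff_fst
  have hS : ContDiff ℝ ∞ fun z : (ℝ × ℝ) × ℝ => levelPoint μ K 0 z.2 + levelPoint μ K ρ' (ϑ' + z.2) :=
    ((hl h0).comp contDiff_snd).add ((hl hρ').comp (contDiff_const.add contDiff_snd))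
  exact (hg.comp hc).mul (hH.comp ((EngineV8.contDiff_frameLevel μ K).comp (hS.sub hc)))

/-- **EVERY BASE-ANGLE DERIVATIVE OF THE FAR-FAR PIECE** at the co-moving pair momentum `R(θ) = Φ(0,θ) + Φ(ρ′,ϑ′+θ)`:
`∂ᵏ_θ ∫_{(−π,π)²} g(q̂)·H(e_K(R(θ) − q̂)) dq = ∫_{(−π,π)²} g(q̂)·∂ᵏ_θ[H(e_K(R(θ) − q̂))] dq`, every `k`. -/
theorem iteratedDeriv_farIntegral_pp_eq {g : Momentum → ℂ} (hg : ContDiff ℝ ∞ g) {H : ℝ → ℂ} (hH : ContDiff ℝ ∞ H) {ρ' : ℝ} (hρ' : |ρ'| < r)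
    (ϑ' : ℝ) (k : ℕ) (θ : ℝ) :
    iteratedDeriv k (fun θ : ℝ => ∫ q in Ioo (-π) π ×ˢ Ioo (-π) π, g (WithLp.toLp 2 ![q.1, q.2]) *
        H (frameLevel μ K (levelPoint μ K 0 θ + levelPoint μ K ρ' (ϑ' + θ) - WithLp.toLp 2 ![q.1, q.2]))) θ =
      ∫ q in Ioo (-π) π ×ˢ Ioo (-π) π, g (WithLp.toLp 2 ![q.1, q.2]) *
        iteratedDeriv k (fun θ : ℝ => H (frameLevel μ K (levelPoint μ K 0 θ + levelPoint μ K ρ' (ϑ' + θ) - WithLp.toLp 2 ![q.1, q.2]))) θ := by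
  rw [iteratedDeriv_zoneBoxIntegral_eq (contDiff_farIntegrand_pp B hA hADt hlo hhi hg hH hρ' ϑ') k θ]
  refine setIntegral_congr_fun (measurableSet_Ioo.prod measurableSet_Ioo) fun q _ => ?_
  show iteratedDeriv k (fun θ : ℝ => g (WithLp.toLp 2 ![q.1, q.2]) *
      H (frameLevel μ K (levelPoint μ K 0 θ + levelPoint μ K ρ' (ϑ' + θ) - WithLp.toLp 2 ![q.1, q.2]))) θ = _
  rw [iteratedDeriv_const_mul (g (WithLp.toLp 2 ![q.1, q.2]))
    ((contDiff_farPartner_pp B hA hADt hlo hhi hH hρ' ϑ' (WithLp.toLp 2 ![q.1, q.2]) (n := ⊤)).contDiffAt.of_le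
      (by exact_mod_cast (le_top : (k : ℕ∞) ≤ ⊤)))]

/-- The far-far piece is `C^∞` in the base angle. -/
theorem contDiff_farIntegral_pp {g : Momentum → ℂ} (hg : ContDiff ℝ ∞ g) {H : ℝ → ℂ} (hH : ContDiff ℝ ∞ H) {ρ' : ℝ} (hρ' : |ρ'| < r) (ϑ' : ℝ) :
    ContDiff ℝ ∞ fun θ : ℝ => ∫ q in Ioo (-π) π ×ˢ Ioo (-π) π, g (WithLp.toLp 2 ![q.1, q.2]) *
      H (frameLevel μ K (levelPoint μ K 0 θ + levelPoint μ K ρ' (ϑ' + θ) - WithLp.toLp 2 ![q.1, q.2])) :=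
  contDiff_zoneBoxIntegral (contDiff_farIntegrand_pp B hA hADt hlo hhi hg hH hρ' ϑ')

/-- **Majorants pass under the far-far zone integral**, pointwise in the zone point. -/
theorem norm_iteratedDeriv_farIntegral_pp_le {g : Momentum → ℂ} (hg : ContDiff ℝ ∞ g) {H : ℝ → ℂ} (hH : ContDiff ℝ ∞ H) {ρ' : ℝ} (hρ' : |ρ'| < r)
    (ϑ' : ℝ) (k : ℕ) (θ : ℝ) {m : ℝ × ℝ → ℝ} (hmi : IntegrableOn m (Ioo (-π) π ×ˢ Ioo (-π) π))
    (hm : ∀ q ∈ (Ioo (-π) π ×ˢ Ioo (-π) π : Set (ℝ × ℝ)), ‖iteratedDeriv k (fun θ : ℝ => g (WithLp.toLp 2 ![q.1, q.2]) *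
        H (frameLevel μ K (levelPoint μ K 0 θ + levelPoint μ K ρ' (ϑ' + θ) - WithLp.toLp 2 ![q.1, q.2]))) θ‖ ≤ m q) :
    ‖iteratedDeriv k (fun θ : ℝ => ∫ q in Ioo (-π) π ×ˢ Ioo (-π) π, g (WithLp.toLp 2 ![q.1, q.2]) *
        H (frameLevel μ K (levelPoint μ K 0 θ + levelPoint μ K ρ' (ϑ' + θ) - WithLp.toLp 2 ![q.1, q.2]))) θ‖ ≤
      ∫ q in Ioo (-π) π ×ˢ Ioo (-π) π, m q :=
  norm_iteratedDeriv_zoneBoxIntegral_le (contDiff_farIntegrand_pp B hA hADt hlo hhi hg hH hρ' ϑ') k θ hmi hm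

omit B hA hADt hlo hhi in
/-- **Counting with no small factor** (the far piece): for `k ≥ 1`, a jet table `|E⁽ʲ⁾(θ)| ≤ G j ≤ Dʲ` (`1 ≤ j ≤ k`, `0 ≤ D`) of the partner level
`E` and GLOBAL derivative bounds `‖H^{(L)}(x)‖ ≤ M L` (`1 ≤ L ≤ k`) give `‖∂ᵏ_θ H(E(θ))‖ ≤ k!·Dᵏ·Σ_{L=1}^{k} M L` — n-free as soon as the `M L` are
(`H = (1−χ)Ψ₂` lives off the Fermi curve). -/
theorem norm_iteratedDeriv_scomp_le_factorial_one {H : ℝ → ℂ} {E : ℝ → ℝ} {k : ℕ} (hk : 1 ≤ k) (hH : ContDiff ℝ k H) (hE : ContDiff ℝ k E)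
    {D : ℝ} (hD : 0 ≤ D) {M G : ℕ → ℝ} (hM : ∀ L, 1 ≤ L → L ≤ k → ∀ x, ‖iteratedDeriv L H x‖ ≤ M L) {θ : ℝ}
    (hG : ∀ j, 1 ≤ j → j ≤ k → |iteratedDeriv j E θ| ≤ G j) (hGD : ∀ j, 1 ≤ j → j ≤ k → G j ≤ D ^ j) :
    ‖iteratedDeriv k (fun θ => H (E θ)) θ‖ ≤ k.factorial * D ^ k * ∑ L ∈ Finset.Icc 1 k, M L := by
  have hG0 : ∀ j, 1 ≤ j → j ≤ k → 0 ≤ G j := fun j h1 h2 => (abs_nonneg _).trans (hG j h1 h2)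
  have h := norm_iteratedDeriv_scomp_le_factorial hk hH.contDiffAt hE.contDiffAt (α := 1) zero_le_one hD (M := M) (G := G)
    (fun L h1 h2 => hM L h1 h2 _) (fun j h1 h2 => by rw [one_mul]; exact hG j h1 h2) hG0 hGD
  simpa only [one_pow, mul_one] using h

end Far

end Summit.HubbardSuperconductivity.HubbardSuperconductivity.Theorems.C4a

end
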